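import Summits.Ventures.PercRepro0.NonBacktrack

/-!
# `θ_d(1) = 1` on `Defs.lean`, and the unconditional lower bound `1/(2d−1) ≤ p_c(d)`

Cell pub-perc-repro0, seat p2.  Under `P_1` every bond is open (`setBernoulli_one`); the lattice is
connected (`lattice_reachable_zero`), so the cluster of the origin is all of `ℤ^d`, infinite for `d ≥ 1`
(`thetaI_one`).  Hence `{p ∈ [0,1] : θ_d(p) > 0}` is nonempty (`pcSet_nonempty`) and the lower bound of
`NonBacktrack.lean` needs no hypothesis beyond `d ≥ 1` (`inv_two_d_sub_one_le_pc'`).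
-/

open MeasureTheory ProbabilityTheory unitInterval
open scoped ENNReal Topology

namespace Summit.Ventures.PercRepro0.L2

open Summit.Ventures.PercRepro0.Defs

variable {d : ℕ}

-- BEGIN BODY

/-! ### `θ_d(1) = 1`: the all-open configuration percolates (removes the nonemptiness hypotheses) -/

/-- `step x i true = x + e_i`. -/
lemma step_true (x : Vertex d) (i : Fin d) : step x i true = Function.update x i (x i + 1) := by
  simp [step]

/-- `step x i false = x − e_i`. -/
lemma step_false (x : Vertex d) (i : Fin d) : step x i false = Function.update x i (x i - 1) := by
  simp [step, sub_eq_add_neg]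

/-- In the lattice, moving one coordinate by any integer amount is a finite path. -/
lemma lattice_reachable_update (x : Vertex d) (i : Fin d) (k : ℤ) :
    (lattice d).Reachable x (Function.update x i (x i + k)) := by
  induction k with
  | zero =>
    have h : Function.update x i (x i + (0 : ℤ)) = x := by simp
    rw [h]
  | succ n ih =>
    refine ih.trans ?_
    have h : Function.update x i (x i + ((n : ℤ) + 1)) =
        step (Function.update x i (x i + n)) i true := by
      rw [step_true]
      simp only [Function.update_self, Function.update_idem]
      congr 1
      ring
    rw [h]
    exact (lattice_adj_step _ i true).reachable
  | pred n ih =>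
    refine ih.trans ?_
    have h : Function.update x i (x i + (-(n : ℤ) - 1)) =
        step (Function.update x i (x i + -(n : ℤ))) i false := by
      rw [step_false]
      simp only [Function.update_self, Function.update_idem]
      congr 1
      ring
    rw [h]
    exact (lattice_adj_step _ i false).reachable

/-- The vertex agreeing with `x` on the coordinates in `S` and vanishing elsewhere. -/
def truncV (S : Finset (Fin d)) (x : Vertex d) : Vertex d :=
  fun i => if i ∈ S then x i else 0

/-- The lattice is connected: every vertex is reachable from the origin. -/
lemma lattice_reachable_zero (x : Vertex d) : (lattice d).Reachable 0 x := by
  classical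
  have key : ∀ S : Finset (Fin d), (lattice d).Reachable 0 (truncV S x) := by
    intro S
    induction S using Finset.induction_on with
    | empty =>
      have : truncV (∅ : Finset (Fin d)) x = 0 := by
        funext i; simp [truncV]
      rw [this]
    | insert i S hi ih =>
      have : truncV (insert i S) x = Function.update (truncV S x) i (truncV S x i + x i) := by
        funext j
        by_cases hj : j = i
        · subst hj; simp [truncV, hi]
        · simp [truncV, hj]
      rw [this]
      exact ih.trans (lattice_reachable_update (truncV S x) i (x i))
  have : truncV Finset.univ x = x := by funext i; simp [truncV]
  rw [← this]
  exact key Finset.univ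

/-- In the all-open configuration `bonds d`, the open graph is the lattice. -/
lemma openGraph_bonds : openGraph d (bonds d) = lattice d := by
  simp only [openGraph, Set.inter_self, bonds, SimpleGraph.fromEdgeSet_edgeSet]

/-- The all-open configuration percolates (`d ≥ 1`). -/
lemma bonds_mem_percolates (hd : 1 ≤ d) : bonds d ∈ percolates d := by
  show (cluster d (bonds d) 0).Infinite
  have : cluster d (bonds d) 0 = Set.univ := by
    ext x
    simp only [cluster, Set.mem_setOf_eq, Set.mem_univ, iff_true, Conn, openGraph_bonds]
    exact lattice_reachable_zero x
  rw [this]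
  haveI : Nonempty (Fin d) := ⟨⟨0, hd⟩⟩
  exact Set.infinite_univ

/-- `θ_d(1) = 1` for `d ≥ 1`. -/
theorem thetaI_one (hd : 1 ≤ d) : thetaI d 1 = 1 := by
  unfold thetaI P
  rw [setBernoulli_one, Measure.dirac_apply' _ measurableSet_percolates,
    Set.indicator_of_mem (bonds_mem_percolates hd)]
  simp

/-- `{p ∈ [0,1] : θ_d(p) > 0}` is nonempty for `d ≥ 1` (it contains `1`). -/
lemma pcSet_nonempty (hd : 1 ≤ d) : (pcSet d).Nonempty := by
  refine ⟨1, ⟨zero_le_one, le_rfl⟩, ?_⟩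
  unfold theta
  have hclamp : clamp (1 : ℝ) = (1 : I) := by
    ext; simp [clamp]
  rw [hclamp, thetaI_one hd]
  exact one_pos

/-- L4(i), unconditional for `d ≥ 1`: `1/(2d−1) ≤ p_c(d)`. -/
theorem inv_two_d_sub_one_le_pc' (hd : 1 ≤ d) : 1 / (2 * (d : ℝ) - 1) ≤ pc d :=
  inv_two_d_sub_one_le_pc hd (pcSet_nonempty hd)

-- END BODY

end Summit.Ventures.PercRepro0.L2
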